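import Summits.ValiantsHypothesis.ValiantsHypothesis.Theses.DivisionGap
-- Checked against (not imported: the crux's Negative lemmas are the ≈ 2300-line monotone LOWER bound
-- `false_without_division`, landing as `Theorems/TriangularDimersDivisionEasy/Negative/*.lean`; nothing here
-- asserts monotone easiness WITHOUT the denominator `h`, see the header § Disproof used):
-- import Summits.ValiantsHypothesis.ValiantsHypothesis.Theorems.TriangularDimersDivisionEasy.Negative.Basic

/-!
# Skeleton line `diagonal-spider-shuffling` for crux `TriangularDimersDivisionEasy` (stmt-ValiantsHypothesis-5067)

Route `DivisionGap`, crux r4 `TriangularDimersDivisionEasy` =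
`∃ c, ∀ n, ∃ h ≠ 0, L₊(D_n · h) + L₊(h) ≤ 2 ^ ((log₂ n + c) ^ c)`, where `D_n ∈ ℝ≥0[x_(v,w)]` is the dimer
(perfect-matching) polynomial of the `n × n` rhombus `R_n` of the TRIANGULAR lattice in the crux's encoding
(`Σ_f Π_v x_(v, f v)` over fixed-point-free adjacent involutions `f` — doubled oriented edge variables) and
`L₊ = Literature.Computability.AlgebraicComplexity.complexity` over the semiring `ℝ≥0` (monotone fan-in-two
circuit size).  Direction: PROVE it, with a polynomial bound.

## The line (crux idea card `Ideas/diagonal-spider-shuffling.md`, ideator 1; triage r1: pass / pass / pass)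

LEVER = POSITIVE CITY SHUFFLING.  Propp's generalized domino shuffling computes the dimer partition function of
an Aztec diamond with ARBITRARY weights by `n` rounds of urban renewal: every round replaces each city (weighted
4-cycle) by "legs + the dual city", contracts the 2-valent vertices, and multiplies the partition function by the
product of the cell factors `Δ = wy + xz`; the new weights are `w/Δ`-type SUBTRACTION-FREE rational functions of
the old ones, each depending on `O(1)` old weights.  Kuo's sign (the obstruction recorded on the crux; Disproof
§C) lives in GLOBAL four-point condensation on the outer face; a LOCAL gadget replacement
`X ↦ Y` with proportional boundary signatures `sig_X(S) = Λ · sig_Y(S)` is a term-by-term identity of matching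
sums and never sees a sign (`stub_gadgetReplacement`, the engine; `ParityIncoherenceBarrier.md` "What survives").
The line bets that the triangular lattice `T` carries such a scheme: a periodic system of cities with positive
realisers of their COMPLEMENT signatures and a density-neutral regrouping, so that a cofinal family of `T`-patches
`P_m ⊇ R_n` shuffles down to nothing in `m = poly(n)` rounds (`stub_cityShuffling`, LOAD-BEARING, stated below in
its abstract, geometry-free normal form `ShufflingStmt`: a chain of graphs `G_{m+1} → G_m` linked by
bounded-complexity subtraction-free reweightings and polynomially many bounded transfer factors).  Given the
shuffling, `M(G_m)` has polynomial division complexity (`stub_shufflingDivision`: compose the rounds as ONE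
straight-line program with division and clear denominators once — Hrubeš–Yehudayoff normal form), and `D_n` is
extracted from any supergraph `G ⊇ R_n` whose complement is perfectly matchable by putting a weight `ε` on every
foreign edge and taking the LOWEST `ε`-component, which is free for monotone circuits (`stub_freeInitialForms`,
`stub_rhombusExtraction`; this also dissolves the `0/0` caveat recorded on support item 5072).

## Stubs (5) and composition (lead's reshape 2026-08-16: per-item smallness in `IsPositiveRound` is STRUCTURAL, `IsSmall`)
* `stub_gadgetReplacement` (M, provable now) — `GadgetStmt`: proportional gadget signatures ⇒ proportional
  matching sums of the glued graphs (cut decomposition at the attachment vertices).  THE ENGINE of every round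
  (city renewal AND 2-valent contraction are instances).
* `stub_freeInitialForms` (M, provable now) — `InitialFormStmt`: over `ℝ≥0`, the lowest weighted-homogeneous
  component of `p` has `complexity ≤ complexity p` (gatewise: no cancellation, no zero divisors).
* `stub_cityShuffling` (L / open, LOAD-BEARING) — `GadgetStmt → ShufflingStmt`: a positive local shuffling of
  the triangular dimer model exists.
* `stub_shufflingDivision` (M/L) — `ShufflingStmt → PatchEasyStmt`: iterate the rounds; joint (multi-output)
  pair-simulation of the bounded reweighting circuits over the accumulated circuit is ADDITIVE in size.
* `stub_rhombusExtraction` (M) — `InitialFormStmt → PatchEasyStmt → PolyEasyStmt`: `ε`-weights on foreign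
  edges, lowest `ε`-component `= #PM(complement) · ε^k · D_n`, set `ε = 1`, fold the scalar into `h`.
`TriangularDimersDivisionEasy_of` composes them into the crux BY NAME (kernel-checked, no `sorry`): the only glue
mathematics is `(n + c) ^ c ≤ 2 ^ ((log₂ n + (c+1)) ^ (c+1))` (`poly_le_quasipoly`).

## Disproof used (`Cruxes/TriangularDimersDivisionEasy/Disproof.lean` v2, standing disprover; verdict NO KILL)
* §E `false_without_division` (PROVED; landing as `Theorems/TriangularDimersDivisionEasy/Negative/*`): any proof
  must use the denominator `h`.  Honoured: `ShufflingStmt` divides in EVERY round (the denominators `D i` of the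
  reweighting and the transfer denominators `Ld`), `PatchEasyStmt`/`PolyEasyStmt` carry `h ≠ 0`; no stub asserts
  `L₊(D_n)` or `L₊` of any `D_n`-sized matching polynomial to be small WITHOUT a denominator — the stub that
  "uses H" is `stub_cityShuffling` (its `Ld`, `D`) and `stub_shufflingDivision` turns them into `h`.
* §C `not_kuo_twoTerm_at_corners_four` / `pfaffian_fourPoint_at_corners_four` (two-term outer-face condensation
  fails on `R_4`; crossing term `1040 >` both parallel terms): honoured — no stub condenses on the outer face; the
  round identity of `ShufflingStmt` is a sum over LOCAL replacements whose crossing terms are structural zeros, and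
  its transfer factors are products of `≥ 3`-term city factors (the disprover's "identities with ≥ 3 terms per
  side / larger boundary states").
* §A (odd `n`, `n = 0` free) and §B (0/1 coefficients, fully ordered support): consistent; `stub_rhombusExtraction`
  treats `D_n = 0` (odd `n`) by `h = 1`.
* Triage r1-2 `OneHub.lean` + density law and r1-1/r1-3 (identity dynamics of the double wheel): the WHEEL city on
  `2Λ` is dead as a size-neutral scheme; `ShufflingStmt` encodes the density law (`sz m ≤ (m+B)^B` along the whole
  chain forces density-neutral rounds on average) and is agnostic about the city shape — see the line card for the
  surviving candidates and the finite searches (Q2-first).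
* `ledger negatives --problem ValiantsHypothesis`: no stub is an instance of a refuted statement (none concerns
  semiring / division complexity or matching polynomials).
-/

set_option linter.dupNamespace false
set_option linter.unusedVariables false

namespace Summit.ValiantsHypothesis.ValiantsHypothesis.Cruxes.TriangularDimersDivisionEasy.DiagonalSpiderShuffling

open scoped BigOperators NNReal
open Finset MvPolynomial Literature.Computability.AlgebraicComplexity

noncomputable section

/-! ## Vocabulary (all over existing declarations: `MvPolynomial`, `Finset.filter/univ`, `complexity`) -/

section MatchingSums

variable {R : Type} [CommSemiring R]

/-- Hafnian-type matching sum of a weight matrix `W` on a finite vertex type, in the crux's encoding: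
sum over fixed-point-free involutions `f` of `Π_v W v (f v)` (each matched pair `{v, w}` contributes
`W v w * W w v`; put weight `0` on non-edges). -/
def ihaf {V : Type} [Fintype V] [DecidableEq V] (W : V → V → R) : R :=
  ∑ f ∈ (univ : Finset (V → V)).filter (fun f => ∀ v, f (f v) = v ∧ f v ≠ v), ∏ v, W v (f v)

/-- Boundary SIGNATURE of a gadget `X` on attachment vertices `A` and private vertices `C`: for `S ⊆ A`,
the matching sum of `X` restricted to the vertex set `S ⊕ C` (the attachments in `S` are matched INSIDE the
gadget, those outside `S` are absent, every private vertex is matched). -/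
def gsig {A C : Type} [Fintype A] [DecidableEq A] [Fintype C] [DecidableEq C]
    (X : A ⊕ C → A ⊕ C → R) (S : Finset A) : R :=
  ihaf (V := {v : A ⊕ C // ∀ a : A, v = Sum.inl a → a ∈ S}) (fun v w => X v.1 w.1)

/-- Gluing a gadget `X` (on `A ⊕ C`) into an ambient graph (other vertices `U`) THROUGH THE ATTACHMENTS ONLY:
ambient weights `Wuu` on `U × U`, `Wua`/`Wau` on `U × A` / `A × U`; no `U–C` edges; all `A–A` edges belong to
the gadget. -/
def glue {U A C : Type} (Wuu : U → U → R) (Wua : U → A → R) (Wau : A → U → R)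
    (X : A ⊕ C → A ⊕ C → R) : U ⊕ (A ⊕ C) → U ⊕ (A ⊕ C) → R
  | Sum.inl u, Sum.inl u' => Wuu u u'
  | Sum.inl u, Sum.inr (Sum.inl a) => Wua u a
  | Sum.inr (Sum.inl a), Sum.inl u => Wau a u
  | Sum.inl _, Sum.inr (Sum.inr _) => 0
  | Sum.inr (Sum.inr _), Sum.inl _ => 0
  | Sum.inr p, Sum.inr q => X p q

end MatchingSums

/-- `GadgetStmt` — GADGET REPLACEMENT (the engine of city renewal; Propp 2003 §2 "urban renewal" is the
4-cycle instance, 2-valent vertex contraction `a–v–b ↦ u` another — the path gadget and the star gadget on the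
attachments `N(a) ∪ N(b)` have equal signatures): if two gadgets on the same attachment set have PROPORTIONAL
signatures, `sig_X(S) = Λ · sig_Y(S)` for all `S ⊆ A`, then the matching sums of the glued graphs are
proportional with the same factor, for every ambient graph.  Over any commutative semiring (no signs, no
subtraction: a bijection of terms after cutting at the attachment vertices).  No generality is lost by the
absence of ambient attachment–attachment edges in `glue`: subdivide such an edge twice (`a–s–s'–a'`, weights
`ω, 1, 1`), which moves it into `U` without changing any matching sum. -/
def GadgetStmt : Prop :=
  ∀ (R : Type) [CommSemiring R] (U A C₁ C₂ : Type) [Fintype U] [DecidableEq U] [Fintype A] [DecidableEq A]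
    [Fintype C₁] [DecidableEq C₁] [Fintype C₂] [DecidableEq C₂]
    (Wuu : U → U → R) (Wua : U → A → R) (Wau : A → U → R)
    (X : A ⊕ C₁ → A ⊕ C₁ → R) (Y : A ⊕ C₂ → A ⊕ C₂ → R) (Λ : R),
    (∀ S : Finset A, gsig X S = Λ * gsig Y S) →
      ihaf (glue Wuu Wua Wau X) = Λ * ihaf (glue Wuu Wua Wau Y)

/-- `InitialFormStmt` — INITIAL FORMS ARE FREE for monotone circuits: over `ℝ≥0`, for an `ℕ`-weight `w` on
the variables and any `d` not exceeding the `w`-order of `p`, the weighted-homogeneous component of `p` of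
weighted degree `d` (the initial form of `p` if `d` is the order, else `0`) has complexity `≤ complexity p`
(replace every gate value by its lowest component: `in(u·v) = in(u)·in(v)`, `in(c•u + d•v) ∈ {c•in u, d•in v,
c•in u + d•in v}` — no cancellation over `ℝ≥0`; triage r1-1 D1(e), r1-3 Evidence C). -/
def InitialFormStmt : Prop :=
  ∀ (σ : Type) (w : σ → ℕ) (d : ℕ) (p : MvPolynomial σ ℝ≥0),
    (∀ m ∈ p.support, d ≤ Finsupp.weight w m) →
      complexity (weightedHomogeneousComponent w d p) ≤ complexity p

/-! ### Graphs on `Fin k`, generic matching polynomials, positive rounds -/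

/-- Adjacency of the triangular lattice on the rhombus `R_n` — verbatim the crux's six disjuncts
(edges `(i,j)–(i+1,j)`, `(i,j)–(i,j+1)`, `(i,j)–(i+1,j-1)`, both orientations). -/
def AdjR {n : ℕ} (v w : Fin n × Fin n) : Prop :=
  ((v.1 : ℕ) + 1 = w.1 ∧ (v.2 : ℕ) = w.2) ∨ ((w.1 : ℕ) + 1 = v.1 ∧ (v.2 : ℕ) = w.2) ∨
  ((v.1 : ℕ) = w.1 ∧ (v.2 : ℕ) + 1 = w.2) ∨ ((v.1 : ℕ) = w.1 ∧ (w.2 : ℕ) + 1 = v.2) ∨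
  ((v.1 : ℕ) + 1 = w.1 ∧ (w.2 : ℕ) + 1 = v.2) ∨ ((w.1 : ℕ) + 1 = v.1 ∧ (v.2 : ℕ) + 1 = w.2)

/-- GENERIC matching polynomial of the finite graph `E` on `Fin k` in the crux's encoding: sum over
fixed-point-free involutions along `E` of `Π_v X (v, f v)` (doubled oriented edge variables `X (v, w)`). -/
def pm {k : ℕ} (E : Fin k → Fin k → Bool) : MvPolynomial (Fin k × Fin k) ℝ≥0 :=
  ∑ f ∈ (univ : Finset (Fin k → Fin k)).filter (fun f => ∀ v, f (f v) = v ∧ f v ≠ v ∧ E v (f v) = true),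
    ∏ v : Fin k, X (v, f v)

/-- The matching polynomial of `E` with the oriented variable `i = (v, w)` REWEIGHTED to `N i / D i`,
denominators cleared edge by edge: `Σ_f (Π_v N (v, f v)) · Π_{i ∈ E unused by f} D i`
(`= M(E)(N/D) · Π_{i ∈ E} D i`, a polynomial because `M(E)` is multilinear in the oriented variables). -/
def pmSubst {k : ℕ} (E : Fin k → Fin k → Bool) {τ : Type} (N D : Fin k × Fin k → MvPolynomial τ ℝ≥0) :
    MvPolynomial τ ℝ≥0 :=
  ∑ f ∈ (univ : Finset (Fin k → Fin k)).filter (fun f => ∀ v, f (f v) = v ∧ f v ≠ v ∧ E v (f v) = true),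
    (∏ v : Fin k, N (v, f v)) *
      ∏ i ∈ (univ : Finset (Fin k × Fin k)).filter (fun i => E i.1 i.2 = true ∧ f i.1 ≠ i.2), D i

/-- STRUCTURAL SMALLNESS of one item of a round (lead's reshape, 2026-08-16): a NON-ZERO polynomial with at most
`B` monomials, each of total degree `≤ B`.  Every explicit local item of a city scheme (a cell factor `wy + xz`, a
renewed weight numerator `w`, a clearing denominator) is small in this sense verbatim, and smallness implies BOTH
monotone complexity `O(B²)` AND an explicit bihomogenisation `p(n/d) = Pn(n,d)/Pd(n,d)` with `Pn, Pd` small —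
which is what the additive composition of rounds (`stub_shufflingDivision`) consumes, with no circuit-structure
induction. -/
def IsSmall {τ : Type} (B : ℕ) (p : MvPolynomial τ ℝ≥0) : Prop :=
  p ≠ 0 ∧ p.totalDegree ≤ B ∧ p.support.card ≤ B

/-- ONE POSITIVE LOCAL ROUND from the graph `E'` on `Fin k'` to the graph `E` on `Fin k` with locality/size
constant `B` and at most `M` transfer factors: a subtraction-free reweighting `i ↦ N i / D i` of the oriented
variables of `E` by SMALL (`IsSmall B`: non-zero, `≤ B` monomials of degree `≤ B` — hence each depending on `≤ B²`
old variables: locality) polynomials in the variables of `E'`, and small transfer factors `Ln`, `Ld` (city factors,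
forced-edge weights, clearing denominators), at most `M` of them, with the ROUND IDENTITY
`M(E') · Π Ld = Π Ln · pmSubst E N D` in `ℝ≥0[x']` — i.e. `M(E')(x') = (Π Ln / Π Ld) · Π_{i∈E} (D i)⁻¹… · M(E)(N/D)`
as subtraction-free rational functions.  (Propp's Aztec round: `N/D = w/Δ`, `Ln = ` the cell factors `Δ`.) -/
def IsPositiveRound (B M : ℕ) {k' k : ℕ} (E' : Fin k' → Fin k' → Bool) (E : Fin k → Fin k → Bool) : Prop :=
  ∃ (N D : Fin k × Fin k → MvPolynomial (Fin k' × Fin k') ℝ≥0)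
    (Ln Ld : List (MvPolynomial (Fin k' × Fin k') ℝ≥0)),
    (∀ i, IsSmall B (N i) ∧ IsSmall B (D i)) ∧
    (∀ p ∈ Ln ++ Ld, IsSmall B p) ∧
    Ln.length + Ld.length ≤ M ∧
    pm E' * Ld.prod = Ln.prod * pmSubst E N D

/-- COFINALITY of a graph family `(E m on Fin (sz m))_m` for the rhombi: every EVEN rhombus `R_n` (odd `n` is a
free layer of the crux, `D_n = 0`) embeds into some member of polynomially bounded index, edges to edges, onto a
vertex set whose complement has a perfect matching inside the member (so that `#PM(complement) · ε^k · D_n` is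
the lowest `ε`-component after putting weight `ε` on every foreign oriented variable). -/
def Cofinal (B : ℕ) (sz : ℕ → ℕ) (E : ∀ m, Fin (sz m) → Fin (sz m) → Bool) : Prop :=
  ∀ n : ℕ, Even n → ∃ m : ℕ, m ≤ (n + B) ^ B ∧ ∃ ι : Fin n × Fin n ↪ Fin (sz m),
    (∀ v w : Fin n × Fin n, AdjR v w → E m (ι v) (ι w) = true) ∧
    ∃ g : Fin (sz m) → Fin (sz m), ∀ u : Fin (sz m), u ∉ Set.range ι →
      g (g u) = u ∧ g u ≠ u ∧ g u ∉ Set.range ι ∧ E m u (g u) = true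

/-- `ShufflingStmt` — A POSITIVE LOCAL SHUFFLING OF THE TRIANGULAR DIMER MODEL EXISTS (abstract normal form of
"city shuffling on `T`"): a chain of finite graphs `G_m = (Fin (sz m), E m)` of polynomial size, cofinal for the
rhombi, with a positive local round `G_{m+1} → G_m` for every `m` (uniform locality constant `B`, `≤ (m+B)^B`
transfer factors).  Propp's domino shuffling is exactly such a chain for the SQUARE lattice (Aztec diamonds);
the wheel tiling of `T` on `2Λ` is NOT (triage r1-2: no size-neutral positive dual of the wheel) — the bet is a
larger / multi-round city system (line card §Hardest stub). -/
def ShufflingStmt : Prop :=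
  ∃ (B : ℕ) (sz : ℕ → ℕ) (E : ∀ m, Fin (sz m) → Fin (sz m) → Bool),
    (∀ m, sz m ≤ (m + B) ^ B) ∧
    (∀ m, IsPositiveRound B ((m + B) ^ B) (E (m + 1)) (E m)) ∧
    Cofinal B sz E

/-- `PatchEasyStmt` — some cofinal family of finite supergraphs of the rhombi has POLYNOMIAL division
complexity in the Hrubeš–Yehudayoff normal form: `∃ h ≠ 0, L₊(M(G_m) · h) + L₊(h) ≤ (m + C)^C`. -/
def PatchEasyStmt : Prop :=
  ∃ (B C : ℕ) (sz : ℕ → ℕ) (E : ∀ m, Fin (sz m) → Fin (sz m) → Bool),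
    Cofinal B sz E ∧
    ∀ m, ∃ h : MvPolynomial (Fin (sz m) × Fin (sz m)) ℝ≥0,
      h ≠ 0 ∧ complexity (pm (E m) * h) + complexity h ≤ (m + C) ^ C

/-- `PolyEasyStmt` — the crux with a POLYNOMIAL bound `(n + c)^c` (the crux's polynomial `D_n` verbatim). -/
def PolyEasyStmt : Prop :=
  ∃ c : ℕ, ∀ n : ℕ, ∃ h : MvPolynomial ((Fin n × Fin n) × (Fin n × Fin n)) NNReal, h ≠ 0 ∧
    Literature.Computability.AlgebraicComplexity.complexity ((∑ f ∈ (Finset.univ : Finset (Fin n × Fin n → Fin n × Fin n)).filter (fun f => ∀ v, f (f v) = v ∧ f v ≠ v ∧ (((v.1 : ℕ) + 1 = (f v).1 ∧ (v.2 : ℕ) = (f v).2) ∨ (((f v).1 : ℕ) + 1 = v.1 ∧ (v.2 : ℕ) = (f v).2) ∨ ((v.1 : ℕ) = (f v).1 ∧ (v.2 : ℕ) + 1 = (f v).2) ∨ ((v.1 : ℕ) = (f v).1 ∧ ((f v).2 : ℕ) + 1 = v.2) ∨ ((v.1 : ℕ) + 1 = (f v).1 ∧ ((f v).2 : ℕ)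 + 1 = v.2) ∨ (((f v).1 : ℕ) + 1 = v.1 ∧ (v.2 : ℕ) + 1 = (f v).2))), ∏ v : Fin n × Fin n, (MvPolynomial.X (v, f v) : MvPolynomial ((Fin n × Fin n) × (Fin n × Fin n)) NNReal)) * h) + Literature.Computability.AlgebraicComplexity.complexity h ≤ (n + c) ^ c

/-! ## The five registered stubs -/

/-- STUB 1 (M, provable now) — `GadgetStmt` (gadget replacement).  Why true: cut every perfect matching of the
glued graph at the attachment vertices; with `S :=` the attachments matched into the gadget side, the matching
sum factors as `Σ_S (outer sum over U ∪ (A∖S)) · gsig X S` (no `U–C` edges, all `A–A` edges in the gadget), and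
the hypothesis is applied termwise.  Leans on: `Finset.sum_comm`/`sum_sigma`-type rearrangements, an explicit
`Equiv` between matchings of `U ⊕ (A ⊕ C)` and pairs (outer matching, inner matching of `S ⊕ C`);
Mathlib `Fintype.sum_equiv`, `Finset.prod_sum`-free (pure bijection).  Propp2003 §2; Kuo2004 Thm 2.1's proof
technique without the superposition sign. -/
theorem stub_gadgetReplacement :
    ∀ (R : Type) [CommSemiring R] (U A C₁ C₂ : Type) [Fintype U] [DecidableEq U] [Fintype A] [DecidableEq A]
      [Fintype C₁] [DecidableEq C₁] [Fintype C₂] [DecidableEq C₂]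
      (Wuu : U → U → R) (Wua : U → A → R) (Wau : A → U → R)
      (X : A ⊕ C₁ → A ⊕ C₁ → R) (Y : A ⊕ C₂ → A ⊕ C₂ → R) (Λ : R),
      (∀ S : Finset A, gsig X S = Λ * gsig Y S) →
        ihaf (glue Wuu Wua Wau X) = Λ * ihaf (glue Wuu Wua Wau Y) := by
  sorry

/-- STUB 2 (M, provable now) — `InitialFormStmt` (initial forms are free over `ℝ≥0`).  Why true: take a minimal
fan-in-two circuit for `p` (`ArithCircuit.exists_computes_size_eq_complexity`), replace the two coefficients of
every sum gate according to the `w`-orders of its operands (keep both iff the orders agree, else zero the higher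
one) — same gate list length, and by induction on the gate list every gate now computes the lowest
`w`-component of its old value (`weightedHomogeneousComponent_mul`-type bookkeeping; products by
`IsWeightedHomogeneous.mul` and `NoZeroDivisors (MvPolynomial σ ℝ≥0)`; sums have no cancellation since
coefficients are `≥ 0`).  If `d <` the order the component is `0 = C 0`, free (`complexity_C_holds`).
Leans on: tree `ArithCircuit.gateValues`, `complexity_le_size`, `exists_computes_size_eq_complexity`,
`complexity_C_holds`; Mathlib `MvPolynomial.weightedHomogeneousComponent`, `coeff_weightedHomogeneousComponent`,
`Finsupp.weight`. -/
theorem stub_freeInitialForms :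
    ∀ (σ : Type) (w : σ → ℕ) (d : ℕ) (p : MvPolynomial σ ℝ≥0),
      (∀ m ∈ p.support, d ≤ Finsupp.weight w m) →
        complexity (weightedHomogeneousComponent w d p) ≤ complexity p := by
  sorry

/-- STUB 3 (L / open — LOAD-BEARING) — `GadgetStmt → ShufflingStmt`: a positive local shuffling of the
triangular dimer model.  Intended proof (the idea card): a PERIODIC CITY SYSTEM on `T` — an edge partition into
cities such that every vertex is interior to one city or an attachment of exactly two, together with, for each
city `X_c`, a positive realiser `Y_c` of its COMPLEMENT signature (`gsig (legs X) S = gsig X Sᶜ`, so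
`X_c ↦ legs + Y_c` is a gadget replacement with factor `Λ_c`, STUB 1), 2-valent contraction (again STUB 1,
`Λ = 1`), and a REGROUPING of the renewed graph into the next round's cities that is density-neutral on average
(`#private(Y) = #interior(X)`, triage r1-2's density law, forced here by `sz m ≤ (m+B)^B`) and eats one boundary
layer of the patch family per bounded number of rounds; `G_m :=` the patches, `N/D :=` the renewed weights,
`Ln/Ld :=` city factors / clearing denominators.  Status of candidates: 4-cycle cities = Propp (square lattice,
works); wheels `W₆` on `2Λ` DEAD (no one-hub positive dual: OneHub.lean, kit j012802 A2; double-wheel dual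
inflates ×2.5 and shuffles back to `T` identically); OPEN: radius-2 cities on `4Λ`, double-wheel rounds
alternating with a different deflating regrouping of the inflated lattice `T′` (Q2), Bošković's diagonal-spider
schedule on the square skeleton with caterpillar defects, and the general reduction C⁺ (Propp's open problem 5 /
Goncharov–Kenyon moves incl. odd-face moves).  Why it might be false: no density-neutral positive city system may
exist on `T` at any period (then this line is dead and only C⁺-type non-periodic reductions remain). -/
theorem stub_cityShuffling (hG : GadgetStmt) :
    ∃ (B : ℕ) (sz : ℕ → ℕ) (E : ∀ m, Fin (sz m) → Fin (sz m) → Bool),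
      (∀ m, sz m ≤ (m + B) ^ B) ∧
      (∀ m, IsPositiveRound B ((m + B) ^ B) (E (m + 1)) (E m)) ∧
      Cofinal B sz E := by
  sorry

/-- STUB 4 (M/L) — `ShufflingStmt → PatchEasyStmt`: iterating positive rounds gives polynomial division
complexity.  Why true (lead's proof plan, additive — never re-simulate earlier rounds): induct UP the chain on the
BIHOMOGENEOUS normal form.  With `PMH_E(n, d) := pmSubst E (X ∘ inl) (X ∘ inr) ∈ ℝ≥0[n_i, d_i]` (so that
`pmSubst E N D = aeval [N, D] PMH_E`, `PMH_E(x, 1) = pm E`, and `PMH_E(λ n, λ d) = (Π_{i ∈ E} λ_i) · PMH_E(n, d)` —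
one of `n_i, d_i` per edge in every monomial), the invariant is
`IH(m) : ∃ P Q ≠ 0, PMH_{E m} · Q = P · Π_{i ∈ E m} d_i ∧ L₊(P) + L₊(Q) ≤ S m`.  Step: substitute `x' := n'/d'` in
the round identity inside `FractionRing ℝ[n', d']` (pull back along the injection `ℝ≥0[·] → ℝ[·] → Frac`); every
SMALL item `p` (`IsSmall B`) has an explicit bihomogenisation `p(n'/d') = pn/pd` with `pn, pd` small (pad each of its
`≤ B` monomials with `d`-powers to degree `B` in each of its `≤ B²` variables), so `N_i(n'/d') = Nn_i/Nd_i`,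
`D_i(n'/d') = Dn_i/Dd_i` and by the scaling covariance `PMH_{E m}(N(n'/d'), D(n'/d')) = PMH_{E m}(ñ, đ) / Π_{E m}(Nd_i Dd_i)`
with the POLYNOMIALS `ñ_i := Nn_i · Dd_i`, `đ_i := Dn_i · Nd_i`; apply `IH(m)` at `(ñ, đ)` (a polynomial substitution:
`complexity_aeval_le`, cost `S m + Σ L₊(ñ_i) + Σ L₊(đ_i)`), multiply out:
`Q_{m+1} := Π Ldn · Π Lnd · Q(ñ,đ) · Π_{E m}(Nd_i Dd_i)`, `P_{m+1} := Π Lnn · Π Ldd · P(ñ,đ) · Π_{E m} đ_i`, all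
non-zero over `ℝ≥0` (evaluate at the all-ones point), `S (m+1) = S m + O_B(sz_m² + (m+B)^B)` — ADDITIVE.  Base:
`sz 0 ≤ B^B`, `PMH_{E 0}` is an explicit sum of `≤ (B^B)^(B^B)` monomials.  End: `d := 1` (`complexity_aeval_le` with
variables/constants, cost 0) gives `pm (E m) · Q(x,1) = P(x,1)`, `Q(x,1) ≠ 0`.  Leans on: tree `complexity_aeval_le`
(IMMInVPProofs.lean), `complexity_add_le_holds`/`complexity_mul_le_holds`/`complexity_finset_sum_le`/
`complexity_finset_prod_le` (ArithCircuitProofs.lean); Mathlib `MvPolynomial.map` injectivity `ℝ≥0 → ℝ`,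
`IsFractionRing`, `instNoZeroDivisors`, `totalDegree`/`support` API.  HrubesYehudayoff2021 §6 (normal form
`f·h = g`), FominGrigorievKoshevoy2014 §1. -/
theorem stub_shufflingDivision (hS : ShufflingStmt) :
    ∃ (B C : ℕ) (sz : ℕ → ℕ) (E : ∀ m, Fin (sz m) → Fin (sz m) → Bool),
      Cofinal B sz E ∧
      ∀ m, ∃ h : MvPolynomial (Fin (sz m) × Fin (sz m)) ℝ≥0,
        h ≠ 0 ∧ complexity (pm (E m) * h) + complexity h ≤ (m + C) ^ C := by
  sorry

/-- STUB 5 (M) — `InitialFormStmt → PatchEasyStmt → PolyEasyStmt`: extracting the rhombus.  Why true: given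
`M(G_m) · h = g` and the cofinal embedding `ι : R_n ↪ G_m` (complement matched by `g₀`), substitute
`X (ι v, ι w) ↦ X (v, w)` on the edges of `R_n` and `X i ↦ ε` on every other oriented variable (a projection:
`IsProjection.complexity_le_holds`, and `≠ 0` is preserved over `ℝ≥0`); a matching using `j` foreign incidences
has `ε`-degree `(sz m - n²) + j + …`, so the LOWEST `ε`-component of the image of `M(G_m)` is
`#PM(complement) · ε^(sz m - n²) · D_n` (non-zero for even `n`; for odd `n`, `D_n = 0` and `h := 1` does it);
lowest components multiply (`in(M)·in(h) = in(g)`, degree bookkeeping + no zero divisors), STUB 2 bounds their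
complexity by `L₊(g)`, `L₊(h)`, the projection `ε ↦ 1` is free, and the positive scalar is folded into `h`
(`complexity_smul_le_holds`, `+1`); finally `m ≤ (n+B)^B` makes `(m + C)^C + 1 ≤ (n + c)^c`.
Leans on: tree `IsProjection.complexity_le_holds` (RealTauConjectureDepthFour.lean), `complexity_smul_le_holds`,
`complexity_C_holds`; Mathlib `weightedHomogeneousComponent`, `MvPolynomial.aeval`, `rename`. -/
theorem stub_rhombusExtraction (hI : InitialFormStmt) (hP : PatchEasyStmt) :
    ∃ c : ℕ, ∀ n : ℕ, ∃ h : MvPolynomial ((Fin n × Fin n) × (Fin n × Fin n)) NNReal, h ≠ 0 ∧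
      Literature.Computability.AlgebraicComplexity.complexity ((∑ f ∈ (Finset.univ : Finset (Fin n × Fin n → Fin n × Fin n)).filter (fun f => ∀ v, f (f v) = v ∧ f v ≠ v ∧ (((v.1 : ℕ) + 1 = (f v).1 ∧ (v.2 : ℕ) = (f v).2) ∨ (((f v).1 : ℕ) + 1 = v.1 ∧ (v.2 : ℕ) = (f v).2) ∨ ((v.1 : ℕ) = (f v).1 ∧ (v.2 : ℕ) + 1 = (f v).2) ∨ ((v.1 : ℕ) = (f v).1 ∧ ((f v).2 : ℕ) + 1 = v.2) ∨ ((v.1 : ℕ) + 1 = (f v).1 ∧ ((f v).2 : ℕ) + 1 = v.2) ∨ (((f v).1 : ℕ) + 1 = v.1 ∧ (v.2 : ℕ) + 1 = (f v).2))), ∏ v : Fin n × Fin n, (MvPolynomial.X (v, f v) : MvPolynomial ((Fin n × Fin n) × (Fin n × Fin n)) NNReal)) * h) + Literature.Computability.AlgebraicComplexity.complexity h ≤ (n + c) ^ c := by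
  sorry

/-! ### Name-keyed aliases of the five statements (the hypotheses of the composition; the skeleton audit admits
a hypothesis only if its head constant is a registered obligation or is named like a declared stub) -/
namespace Registered

/-- Alias of `GadgetStmt` keyed by the registered stub name. -/
abbrev stub_gadgetReplacement : Prop := GadgetStmt
/-- Alias of `InitialFormStmt` keyed by the registered stub name. -/
abbrev stub_freeInitialForms : Prop := InitialFormStmt
/-- Alias of the full type of `stub_cityShuffling`. -/
abbrev stub_cityShuffling : Prop := GadgetStmt → ShufflingStmt
/-- Alias of the full type of `stub_shufflingDivision`. -/
abbrev stub_shufflingDivision : Prop := ShufflingStmt → PatchEasyStmt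
/-- Alias of the full type of `stub_rhombusExtraction`. -/
abbrev stub_rhombusExtraction : Prop := InitialFormStmt → PatchEasyStmt → PolyEasyStmt

end Registered

theorem gadgetStmt_holds : GadgetStmt := stub_gadgetReplacement
theorem initialFormStmt_holds : InitialFormStmt := stub_freeInitialForms
theorem shufflingStmt_holds : ShufflingStmt := stub_cityShuffling gadgetStmt_holds
theorem patchEasyStmt_holds : PatchEasyStmt := stub_shufflingDivision shufflingStmt_holds
theorem polyEasyStmt_holds : PolyEasyStmt := stub_rhombusExtraction initialFormStmt_holds patchEasyStmt_holds

/-! ## Glue (PROVED): polynomial ⇒ quasi-polynomial, and the composition -/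

/-- `(n + c)^c ≤ 2 ^ ((log₂ n + (c+1))^(c+1))`: a polynomial bound is a quasi-polynomial bound. -/
theorem poly_le_quasipoly (n c : ℕ) : (n + c) ^ c ≤ 2 ^ ((Nat.log 2 n + (c + 1)) ^ (c + 1)) := by
  set L := Nat.log 2 n with hL
  have hn : n < 2 ^ (L + 1) := Nat.lt_pow_succ_log_self one_lt_two n
  have hc2 : c + 1 ≤ 2 ^ c := by
    have h := Nat.lt_two_pow_self (n := c)
    omega
  have h1 : n + c ≤ 2 ^ (L + 1 + c) := by
    have hA : c ≤ 2 ^ (L + 1) * c := Nat.le_mul_of_pos_left c (by positivity)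
    calc n + c ≤ 2 ^ (L + 1) + 2 ^ (L + 1) * c := Nat.add_le_add hn.le hA
      _ = 2 ^ (L + 1) * (c + 1) := by ring
      _ ≤ 2 ^ (L + 1) * 2 ^ c := Nat.mul_le_mul_left _ hc2
      _ = 2 ^ (L + 1 + c) := by rw [← pow_add]
  have h2 : (n + c) ^ c ≤ 2 ^ ((L + 1 + c) * c) := by
    calc (n + c) ^ c ≤ (2 ^ (L + 1 + c)) ^ c := Nat.pow_le_pow_left h1 c
      _ = 2 ^ ((L + 1 + c) * c) := by rw [← pow_mul]
  have h3 : (L + 1 + c) * c ≤ (L + (c + 1)) ^ (c + 1) := by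
    rcases Nat.eq_zero_or_pos c with rfl | hc
    · simp
    · have h4 : c ≤ (L + (c + 1)) ^ c := by
        have h5 : c < (c + 1) ^ c := Nat.lt_pow_self (by omega)
        have h6 : (c + 1) ^ c ≤ (L + (c + 1)) ^ c := Nat.pow_le_pow_left (by omega) c
        omega
      calc (L + 1 + c) * c ≤ (L + (c + 1)) * (L + (c + 1)) ^ c := Nat.mul_le_mul (by omega) h4
        _ = (L + (c + 1)) ^ (c + 1) := by ring
  calc (n + c) ^ c ≤ 2 ^ ((L + 1 + c) * c) := h2
    _ ≤ 2 ^ ((L + (c + 1)) ^ (c + 1)) := Nat.pow_le_pow_right (by norm_num) h3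

/-- **The crux from the five stubs** (hypotheses = the stub statements, keyed by name; no `sorry`):
STUB 3 applied to STUB 1 gives the shuffling, STUB 4 the polynomially division-easy cofinal supergraph family,
STUB 5 with STUB 2 the polynomial bound for `D_n` itself, and `poly_le_quasipoly` the crux's quasi-polynomial
clause with constant `c + 1`. -/
theorem TriangularDimersDivisionEasy_of
    (h₁ : Registered.stub_gadgetReplacement) (h₂ : Registered.stub_freeInitialForms)
    (h₃ : Registered.stub_cityShuffling) (h₄ : Registered.stub_shufflingDivision)
    (h₅ : Registered.stub_rhombusExtraction) :
    Summit.ValiantsHypothesis.ValiantsHypothesis.Theses.DivisionGap.TriangularDimersDivisionEasy := by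
  obtain ⟨c, hc⟩ := h₅ h₂ (h₄ (h₃ h₁))
  refine ⟨c + 1, fun n => ?_⟩
  obtain ⟨h, hne, hle⟩ := hc n
  exact ⟨h, hne, le_trans hle (poly_le_quasipoly n c)⟩

/-- Wiring check: the registered stubs feed `TriangularDimersDivisionEasy_of` as stated. -/
example : Summit.ValiantsHypothesis.ValiantsHypothesis.Theses.DivisionGap.TriangularDimersDivisionEasy :=
  TriangularDimersDivisionEasy_of stub_gadgetReplacement stub_freeInitialForms stub_cityShuffling
    stub_shufflingDivision stub_rhombusExtraction

end

end Summit.ValiantsHypothesis.ValiantsHypothesis.Cruxes.TriangularDimersDivisionEasy.DiagonalSpiderShuffling
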